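import Literature.Barriers.ABC.BakerMethodBoundsWeakArchProofs
import HarnessLib

/-!
# Proofs for `BakerMethodBounds`, VII-A: the `p`-adic routes and regime I from the two `p`-adic PLACE BOUNDS

`Literature/Barriers/ABC/BakerMethodBoundsKummerPlaceBoundsProofs.lean` — proofs companion of the barrier file
`Literature/Barriers/ABC/BakerMethodBounds.lean` (theorems only; no definition, no named fact).

Files III (`BakerMethodBoundsWeakArchProofs.lean`) and VI (`BakerMethodBoundsKummerArchProofs.lean`) derive the
barrier declaration `BakerMethodBounds = BakerShapeBound (1/3) 3` (Stewart–Yu 2001, Theorem 1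
[cite: StewartYu2001, Theorem 1]) from the rational `p`-adic clause `hP2` (all finite families of non-torsion
rational generators) and — in file VI — an archimedean bound for `≤ 4` logarithms under a `2`-Kummer condition,
which the tree DISCHARGES by `Literature.NumberTheory.Transcendental.Waldschmidt1980.waldschmidt1980_hW₂`.  Along that
deduction `hP2` is consumed ONLY through `padic_bound_a₂` / `padic_bound_c₂` at threshold `N = 0`, i.e. through the
two `p`-adic PLACE BOUNDS (`theta K u v 0 = K^{ω(uv)+1} ∏_{q ∣ uv} log q`, `theta_zero_eq`;
`Y = log max{e, 2 log c}`):

* (p ∣ a) `ν_p(a) log p < Θ_{bc} · (p / log p)(log p + Y)`,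
* (p ∣ c) `ν_p(c) log p < Θ_{ab} · (p / log p)(log p + Y)` for `ab > 1`,

which concern linear forms in logarithms of DISTINCT PRIMES only.  This file (part A) and its sequel (part B,
`BakerMethodBoundsKummerPlaceBoundsRegimeTwoProofs.lean`) re-run the deduction of file VI with these two place bounds
as hypotheses instead of `hP2` — verbatim copies of `log_le_route_a₂`, `log_lt_route_c₂`, `log_pow_three_le_of_le_sq`,
`log_le_of_le_sq` (regime I: `c ≤ a²`, no archimedean input), `logHeight₁_smooth_le`, `log_le_of_primes_le` with every
`padic_bound_a₂ hK hP2 h 0 …` / `padic_bound_c₂ hK hP2 h h1 0 …` replaced by the hypothesis; part B does the same for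
the Kummer second regime `log_le_of_sq_lt_kummer₂` and the assembly, ending in
`BakerMethodBounds_of_placeBounds_kummerArchBound₂ : 1 ≤ K → (p∣a bound) → (p∣c bound) → (Kummer arch bound) →
BakerMethodBounds`.  The point (cell abc-stewartyu, rung route `PadicPrimesKummerThird`, support `KummerDoor`): the
two place bounds follow from `p`-adic bounds for RATIONAL PRIMES of Yu-2007 quality (`K^{#S}`, `p/(log p)²` in
`ord_p` units, one logarithm), so the exponent `1/3` needs no general rational `p`-adic clause and no archimedean
input beyond Waldschmidt 1980.  Everything here is the tree's own deduction re-keyed; no new mathematics.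

## References

* [StewartYu2001] C. L. Stewart, K. Yu, *On the abc conjecture, II*, Duke Math. J. 108 (2001), 169–181 —
  Theorem 1 and §3.
* [Pasten2024] H. Pasten, Invent. Math. 236 (2024) — §§4–5 (the `p`-adic place bounds at threshold `N`).
* [Waldschmidt1980] M. Waldschmidt, Acta Arith. 37 (1980) — Prop. 3.8 (the archimedean input of regime II).
-/

noncomputable section

open Finset Real Height
open Literature.NumberTheory.DiophantineGeometry
open Literature.NumberTheory.DiophantineGeometry.Dioph
open Literature.NumberTheory.DiophantineGeometry.Pasten

namespace Literature.Barriers.ABC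

section PlaceBoundsRoutes

variable {K : ℝ} {a b c : ℕ}

/-- **Route through `a`, `p`-adic part only:** `log a ≤ Θ_{bc} · Y · 3 ∑_{p ∣ a} p` with
`Θ_{bc} = theta K b c 0`, `Y = log max{e, 2 log c}`. [cite: StewartYu2001, §3, as reconstructed] -/
theorem log_le_route_a₂_placeBounds (hK : 1 ≤ K)
    (hpad : ∀ {a b c : ℕ}, IsABCTriple a b c → ∀ {p : ℕ}, p.Prime → p ∣ a →
      (a.factorization p : ℝ) * Real.log p < theta K b c 0 *
        ((p / Real.log p) * (Real.log p + Real.log (max (Real.exp 1) (2 * Real.log c)))))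
    (h : IsABCTriple a b c) :
    Real.log a ≤ theta K b c 0 * Real.log (max (Real.exp 1) (2 * Real.log c)) *
      (3 * ∑ p ∈ a.primeFactors, (p : ℝ)) := by
  obtain ⟨ha, hb, habc, hcop⟩ := id h
  set Θ := theta K b c 0 with hΘ
  set Y := Real.log (max (Real.exp 1) (2 * Real.log c)) with hY
  have hY1 : 1 ≤ Y := one_le_log_max_exp _
  have hΘ0 : 0 ≤ Θ := theta_nonneg (zero_le_one.trans hK) b c 0
  have hloga : Real.log a = ∑ p ∈ a.primeFactors, (a.factorization p : ℝ) * Real.log p :=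
    log_eq_sum_factorization_mul_log ha.ne'
  have hsum : ∑ p ∈ a.primeFactors, (a.factorization p : ℝ) * Real.log p ≤
      ∑ p ∈ a.primeFactors, Θ * (3 * p * Y) := by
    refine Finset.sum_le_sum fun p hp => ?_
    have hp' := Nat.prime_of_mem_primeFactors hp
    have hpa := Nat.dvd_of_mem_primeFactors hp
    have h1 := hpad h hp' hpa
    have h2 : (p : ℝ) / Real.log p * (Real.log p + Y) ≤ 3 * p * Y :=
      div_log_mul_add_le (by exact_mod_cast hp'.two_le) hY1
    exact (h1.trans_le (mul_le_mul_of_nonneg_left h2 hΘ0)).le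
  have hsum' : ∑ p ∈ a.primeFactors, Θ * (3 * p * Y) =
      Θ * Y * (3 * ∑ p ∈ a.primeFactors, (p : ℝ)) := by
    rw [Finset.mul_sum, Finset.mul_sum]
    exact Finset.sum_congr rfl fun p _ => by ring
  rw [hloga, ← hsum']; exact hsum

/-- **Route through `c`, from the `p`-adic clause alone** (needs `ab > 1`):
`log c < Θ_{ab} · Y · (1 + 3 ∑_{p ∣ c} p)`. [cite: StewartYu2001, §3, as reconstructed] -/
theorem log_lt_route_c₂_placeBounds (hK : 1 ≤ K)
    (hpadc : ∀ {a b c : ℕ}, IsABCTriple a b c → 1 < a * b → ∀ {p : ℕ}, p.Prime → p ∣ c →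
      (c.factorization p : ℝ) * Real.log p < theta K a b 0 *
        ((p / Real.log p) * (Real.log p + Real.log (max (Real.exp 1) (2 * Real.log c)))))
    (h : IsABCTriple a b c) (h1 : 1 < a * b) :
    Real.log c < theta K a b 0 * Real.log (max (Real.exp 1) (2 * Real.log c)) *
      (1 + 3 * ∑ p ∈ c.primeFactors, (p : ℝ)) := by
  obtain ⟨ha, hb, habc, hcop⟩ := id h
  set Θ := theta K a b 0 with hΘ
  set Y := Real.log (max (Real.exp 1) (2 * Real.log c)) with hY
  have hc : c ≠ 0 := by omega
  have hY1 : 1 ≤ Y := one_le_log_max_exp _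
  have hΘpos : 0 < Θ := theta_zero_pos hK ha.ne' hb.ne' hcop
  have hΘ0 : 0 ≤ Θ := hΘpos.le
  have hlogc : Real.log c = ∑ p ∈ c.primeFactors, (c.factorization p : ℝ) * Real.log p :=
    log_eq_sum_factorization_mul_log hc
  have hsum : ∑ p ∈ c.primeFactors, (c.factorization p : ℝ) * Real.log p ≤
      ∑ p ∈ c.primeFactors, Θ * (3 * p * Y) := by
    refine Finset.sum_le_sum fun p hp => ?_
    have hp' := Nat.prime_of_mem_primeFactors hp
    have hpc := Nat.dvd_of_mem_primeFactors hp
    have h1' := hpadc h h1 hp' hpc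
    have h2 : (p : ℝ) / Real.log p * (Real.log p + Y) ≤ 3 * p * Y :=
      div_log_mul_add_le (by exact_mod_cast hp'.two_le) hY1
    exact (h1'.trans_le (mul_le_mul_of_nonneg_left h2 hΘ0)).le
  have hsum' : ∑ p ∈ c.primeFactors, Θ * (3 * p * Y) =
      Θ * Y * (3 * ∑ p ∈ c.primeFactors, (p : ℝ)) := by
    rw [Finset.mul_sum, Finset.mul_sum]
    exact Finset.sum_congr rfl fun p _ => by ring
  have hΘY : 0 < Θ * Y := mul_pos hΘpos (lt_of_lt_of_le one_pos hY1)
  calc Real.log c = ∑ p ∈ c.primeFactors, (c.factorization p : ℝ) * Real.log p := hlogc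
    _ ≤ Θ * Y * (3 * ∑ p ∈ c.primeFactors, (p : ℝ)) := by rw [← hsum']; exact hsum
    _ < Θ * Y + Θ * Y * (3 * ∑ p ∈ c.primeFactors, (p : ℝ)) := by linarith
    _ = Θ * Y * (1 + 3 * ∑ p ∈ c.primeFactors, (p : ℝ)) := by ring

/-- **The cube of the three `p`-adic routes when `a ≤ b` and `c ≤ a²`.** Then
`log c ≤ 2 log a` and `log c ≤ 2 log b`, so the archimedean clause is not needed:
`(log c)³ ≤ 64 K⁹ (2C)³ Λ⁶ Y³ R` with `R = rad(abc)`, `Λ = max(1, log R)`,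
`Y = log max{e, 2 log c}`, `C` bounding the products `∏ 4K²(log p)²/p` over finite sets of primes.
[cite: StewartYu2001, Theorem 1 (proof), as reconstructed in the module docstring] -/
theorem log_pow_three_le_of_le_sq_placeBounds (hK : 1 ≤ K)
    (hpad : ∀ {a b c : ℕ}, IsABCTriple a b c → ∀ {p : ℕ}, p.Prime → p ∣ a →
      (a.factorization p : ℝ) * Real.log p < theta K b c 0 *
        ((p / Real.log p) * (Real.log p + Real.log (max (Real.exp 1) (2 * Real.log c)))))
    (hpadc : ∀ {a b c : ℕ}, IsABCTriple a b c → 1 < a * b → ∀ {p : ℕ}, p.Prime → p ∣ c →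
      (c.factorization p : ℝ) * Real.log p < theta K a b 0 *
        ((p / Real.log p) * (Real.log p + Real.log (max (Real.exp 1) (2 * Real.log c)))))
    {C : ℝ} (hC1 : 1 ≤ C)
    (hC : ∀ S : Finset ℕ, (∀ p ∈ S, p.Prime) → ∏ p ∈ S, 4 * K ^ 2 * Real.log p ^ 2 / p ≤ C)
    (h : IsABCTriple a b c) (hab : a ≤ b) (hca : (c : ℝ) ≤ (a : ℝ) ^ 2) :
    Real.log c ^ 3 ≤ 64 * K ^ 9 * (2 * C) ^ 3 * max 1 (Real.log (rad a b c : ℕ)) ^ 6 *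
      Real.log (max (Real.exp 1) (2 * Real.log c)) ^ 3 * (rad a b c : ℝ) := by
  obtain ⟨ha, hb, habc, hcop⟩ := id h
  have hc : c ≠ 0 := by omega
  have hbc : b.Coprime c := coprime_right_of_isABCTriple h
  have hac : a.Coprime c := coprime_left_of_isABCTriple h
  have habc0 : a * b * c ≠ 0 := by positivity
  -- `a ≥ 2`, hence `ab > 1`
  have ha_r : (0 : ℝ) < a := by exact_mod_cast ha
  have hb_r : (0 : ℝ) < b := by exact_mod_cast hb
  have hc_r : (0 : ℝ) < c := by exact_mod_cast (Nat.pos_of_ne_zero hc)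
  have hac_lt : (a : ℝ) < c := by exact_mod_cast (show a < c by omega)
  have ha2 : 2 ≤ a := by
    by_contra hlt
    have ha1 : a = 1 := by omega
    subst ha1
    norm_num at hca
    have : (2 : ℝ) ≤ c := by exact_mod_cast (show 2 ≤ c by omega)
    linarith
  have h1 : 1 < a * b := by nlinarith
  set y := Real.log c with hy
  set Y := Real.log (max (Real.exp 1) (2 * Real.log c)) with hYdef
  have hy0 : 0 ≤ y := Real.log_nonneg (by exact_mod_cast Nat.one_le_iff_ne_zero.mpr hc)
  have hY1 : 1 ≤ Y := one_le_log_max_exp _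
  have hY0 : 0 ≤ 2 * Y := by linarith
  have hΛ1 : 1 ≤ max 1 (Real.log (rad a b c : ℕ)) := le_max_left _ _
  have hK0 : 0 ≤ K := zero_le_one.trans hK
  -- `y ≤ 2 log a`, `y ≤ 2 log b`
  have hlogsq : ∀ x : ℝ, Real.log (x ^ 2) = 2 * Real.log x := fun x => by
    rw [Real.log_pow]; push_cast; ring
  have hya : y ≤ 2 * Real.log a := by
    rw [← hlogsq]; exact Real.log_le_log hc_r hca
  have hyb : y ≤ 2 * Real.log b := by
    have hab_r : (a : ℝ) ≤ b := by exact_mod_cast hab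
    have hcb : (c : ℝ) ≤ (b : ℝ) ^ 2 := hca.trans (pow_le_pow_left₀ ha_r.le hab_r 2)
    rw [← hlogsq]; exact Real.log_le_log hc_r hcb
  -- the three routes
  have hA0 := log_le_route_a₂_placeBounds hK hpad h
  have hB0 := log_le_route_a₂_placeBounds hK hpad h.swap
  have hC0 := log_lt_route_c₂_placeBounds hK hpadc h h1
  have hΘbc : 0 < theta K b c 0 := theta_zero_pos hK hb.ne' hc hbc
  have hΘac : 0 < theta K a c 0 := theta_zero_pos hK ha.ne' hc hac
  have hΘab : 0 < theta K a b 0 := theta_zero_pos hK ha.ne' hb.ne' hcop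
  have hsum0 : ∀ n : ℕ, 0 ≤ ∑ p ∈ n.primeFactors, ((p : ℕ) : ℝ) := fun n =>
    Finset.sum_nonneg fun p _ => Nat.cast_nonneg p
  have hA : y < theta K b c 0 * (2 * Y) * (1 + 3 * ∑ p ∈ a.primeFactors, (p : ℝ)) := by
    have := hsum0 a
    have hpos : 0 < theta K b c 0 * (2 * Y) := by positivity
    nlinarith
  have hB : y < theta K a c 0 * (2 * Y) * (1 + 3 * ∑ p ∈ b.primeFactors, (p : ℝ)) := by
    have := hsum0 b
    have hpos : 0 < theta K a c 0 * (2 * Y) := by positivity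
    nlinarith
  have hCc : y < theta K a b 0 * (2 * Y) * (1 + 3 * ∑ p ∈ c.primeFactors, (p : ℝ)) := by
    have := hsum0 c
    have hpos : 0 < theta K a b 0 * Y * (1 + 3 * ∑ p ∈ c.primeFactors, (p : ℝ)) := by positivity
    nlinarith
  rw [theta_zero_eq_split K hb.ne' hc hbc] at hA
  rw [theta_zero_eq_split K ha.ne' hc hac] at hB
  rw [theta_zero_eq_split K ha.ne' hb.ne' hcop] at hCc
  -- per-member accounting
  have hprime : ∀ n : ℕ, ∀ p ∈ n.primeFactors, p.Prime := fun n p hp =>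
    Nat.prime_of_mem_primeFactors hp
  have hlogle : ∀ {n : ℕ}, n ∣ a * b * c → ∀ p ∈ n.primeFactors,
      Real.log p ≤ max 1 (Real.log (rad a b c : ℕ)) := by
    intro n hn p hp
    have hp' := Nat.prime_of_mem_primeFactors hp
    have hpR : (p : ℝ) ≤ (rad a b c : ℝ) := by
      exact_mod_cast prime_le_rad hp' ((Nat.dvd_of_mem_primeFactors hp).trans hn) habc0
    have hp0 : (0 : ℝ) < p := by exact_mod_cast hp'.pos
    exact (Real.log_le_log hp0 hpR).trans (le_max_right _ _)
  have hXa := member_accounting hK hC1 hC hΛ1 a.primeFactors (hprime a)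
    (hlogle (Dvd.intro (b * c) (by ring)))
  have hXb := member_accounting hK hC1 hC hΛ1 b.primeFactors (hprime b)
    (hlogle (Dvd.intro (a * c) (by ring)))
  have hXc := member_accounting hK hC1 hC hΛ1 c.primeFactors (hprime c)
    (hlogle (Dvd.intro_left (a * b) rfl))
  -- the radical
  have hRprod : ((rad a b c : ℕ) : ℝ) = (∏ p ∈ a.primeFactors, (p : ℝ)) *
      (∏ p ∈ b.primeFactors, (p : ℝ)) * ∏ p ∈ c.primeFactors, (p : ℝ) := by
    rw [rad_def, Nat.radical_eq_prod_primeFactors, Nat.cast_prod,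
      prod_primeFactors_mul_of_coprime (mul_ne_zero ha.ne' hb.ne') hc (Nat.Coprime.mul_left hac hbc),
      prod_primeFactors_mul_of_coprime ha.ne' hb.ne' hcop]
  have key := cube_combine hK0 hy0 hY0 (hsum0 a) (hsum0 b) (hsum0 c) hA hB hCc hXa hXb hXc
  calc Real.log c ^ 3 ≤ _ := key
    _ = 64 * K ^ 9 * (2 * C) ^ 3 * max 1 (Real.log (rad a b c : ℕ)) ^ 6 * Y ^ 3 *
          ((∏ p ∈ a.primeFactors, (p : ℝ)) * (∏ p ∈ b.primeFactors, (p : ℝ)) *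
            ∏ p ∈ c.primeFactors, (p : ℝ)) := by ring
    _ = _ := by rw [hRprod]

/-- **First regime, the bound:** for an abc triple with `a ≤ b` and `c ≤ a²`,
`log c ≤ 64 K³ (2C) (log(32 K³ C) + 3) · R^{1/3} (log R)³` from the `p`-adic clause alone.
[cite: StewartYu2001, Theorem 1 (proof), as reconstructed in the module docstring] -/
theorem log_le_of_le_sq_placeBounds (hK : 1 ≤ K)
    (hpad : ∀ {a b c : ℕ}, IsABCTriple a b c → ∀ {p : ℕ}, p.Prime → p ∣ a →
      (a.factorization p : ℝ) * Real.log p < theta K b c 0 *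
        ((p / Real.log p) * (Real.log p + Real.log (max (Real.exp 1) (2 * Real.log c)))))
    (hpadc : ∀ {a b c : ℕ}, IsABCTriple a b c → 1 < a * b → ∀ {p : ℕ}, p.Prime → p ∣ c →
      (c.factorization p : ℝ) * Real.log p < theta K a b 0 *
        ((p / Real.log p) * (Real.log p + Real.log (max (Real.exp 1) (2 * Real.log c)))))
    {C : ℝ} (hC1 : 1 ≤ C)
    (hC : ∀ S : Finset ℕ, (∀ p ∈ S, p.Prime) → ∏ p ∈ S, 4 * K ^ 2 * Real.log p ^ 2 / p ≤ C)
    (h : IsABCTriple a b c) (hab : a ≤ b) (hca : (c : ℝ) ≤ (a : ℝ) ^ 2) :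
    Real.log c ≤ 64 * K ^ 3 * (2 * C) * (Real.log (16 * K ^ 3 * (2 * C)) + 3) *
      (rad a b c : ℝ) ^ (1 / 3 : ℝ) * Real.log (rad a b c : ℕ) ^ 3 := by
  obtain ⟨ha, hb, habc, hcop⟩ := id h
  have hR2 : (2 : ℝ) ≤ (rad a b c : ℝ) := by
    have : 2 ≤ rad a b c := by
      rw [rad_def, Nat.two_le_radical_iff]
      calc 2 ≤ c := by omega
        _ ≤ a * b * c := Nat.le_mul_of_pos_left c (by positivity)
    exact_mod_cast this
  have hcube := log_pow_three_le_of_le_sq_placeBounds hK hpad hpadc hC1 hC h hab hca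
  have h2C : 1 ≤ 2 * C := by linarith
  have := le_of_cube_le (K := K) hK h2C hR2 hcube
  simpa using this

/-- **Height of the smooth part.** For an abc triple with `ab > 1`, a set `S` of primes of `cb`
all `≤ τ`, and `β = ∏_{q ∈ S} q^{e_q}` (`e_q = ν_q(c) − ν_q(b)`):
`h(β) ≤ #S · (Θ_{ab} + Θ_{ac}) · 3τY`, `Y = log max{e, 2 log c}` — every exponent is paid for by
the `p`-adic clause at the (small) prime `q`. [cite: StewartYu2001, Theorem 1 (proof), as reconstructed] -/
theorem logHeight₁_smooth_le_placeBounds (hK : 1 ≤ K)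
    (hpad : ∀ {a b c : ℕ}, IsABCTriple a b c → ∀ {p : ℕ}, p.Prime → p ∣ a →
      (a.factorization p : ℝ) * Real.log p < theta K b c 0 *
        ((p / Real.log p) * (Real.log p + Real.log (max (Real.exp 1) (2 * Real.log c)))))
    (hpadc : ∀ {a b c : ℕ}, IsABCTriple a b c → 1 < a * b → ∀ {p : ℕ}, p.Prime → p ∣ c →
      (c.factorization p : ℝ) * Real.log p < theta K a b 0 *
        ((p / Real.log p) * (Real.log p + Real.log (max (Real.exp 1) (2 * Real.log c)))))
    (h : IsABCTriple a b c) (h1 : 1 < a * b) (S : Finset ℕ) (hS : S ⊆ (c * b).primeFactors)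
    {τ : ℝ} (hSτ : ∀ q ∈ S, (q : ℝ) ≤ τ) :
    logHeight₁ (∏ q ∈ S, (q : ℚ) ^ expDiff c b q) ≤
      S.card * ((theta K a b 0 + theta K a c 0) *
        (3 * τ * Real.log (max (Real.exp 1) (2 * Real.log c)))) := by
  obtain ⟨ha, hb, habc, hcop⟩ := id h
  have hc : c ≠ 0 := by omega
  have hcb : c.Coprime b := (coprime_right_of_isABCTriple h).symm
  set Y := Real.log (max (Real.exp 1) (2 * Real.log c)) with hYdef
  have hY1 : 1 ≤ Y := one_le_log_max_exp _
  have hΘab : 0 ≤ theta K a b 0 := theta_nonneg (zero_le_one.trans hK) a b 0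
  have hΘac : 0 ≤ theta K a c 0 := theta_nonneg (zero_le_one.trans hK) a c 0
  -- per prime of `S`
  have hq : ∀ q ∈ S, ((expDiff c b q).natAbs : ℝ) * Real.log q ≤
      (theta K a b 0 + theta K a c 0) * (3 * τ * Y) := by
    intro q hqS
    have hqP := hS hqS
    have hqp : q.Prime := Nat.prime_of_mem_primeFactors hqP
    have hq2 : (2 : ℝ) ≤ q := by exact_mod_cast hqp.two_le
    have hlogq : 0 ≤ Real.log q := Real.log_nonneg (by linarith)
    have hnum : (q : ℝ) / Real.log q * (Real.log q + Y) ≤ 3 * q * Y :=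
      div_log_mul_add_le hq2 hY1
    have hnum0 : 0 ≤ (q : ℝ) / Real.log q * (Real.log q + Y) := by positivity
    have hqτ : 3 * (q : ℝ) * Y ≤ 3 * τ * Y := by
      have := hSτ q hqS; nlinarith
    -- `ν_q(c) log q ≤ Θ_{ab} (…)` and `ν_q(b) log q ≤ Θ_{ac} (…)`
    have hcq : (c.factorization q : ℝ) * Real.log q ≤
        theta K a b 0 * ((q : ℝ) / Real.log q * (Real.log q + Y)) := by
      by_cases hqc : q ∣ c
      · exact (hpadc h h1 hqp hqc).le
      · rw [Nat.factorization_eq_zero_of_not_dvd hqc, Nat.cast_zero, zero_mul]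
        positivity
    have hbq : (b.factorization q : ℝ) * Real.log q ≤
        theta K a c 0 * ((q : ℝ) / Real.log q * (Real.log q + Y)) := by
      by_cases hqb : q ∣ b
      · exact (hpad h.swap hqp hqb).le
      · rw [Nat.factorization_eq_zero_of_not_dvd hqb, Nat.cast_zero, zero_mul]
        positivity
    have hsplit : ((expDiff c b q).natAbs : ℝ) = c.factorization q + b.factorization q := by
      rw [natAbs_expDiff hc hb.ne' hcb q, Nat.factorization_mul hc hb.ne', Finsupp.add_apply]
      push_cast; rfl
    rw [hsplit, add_mul]
    calc (c.factorization q : ℝ) * Real.log q + (b.factorization q : ℝ) * Real.log q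
        ≤ (theta K a b 0 + theta K a c 0) * ((q : ℝ) / Real.log q * (Real.log q + Y)) := by
          linarith
      _ ≤ (theta K a b 0 + theta K a c 0) * (3 * τ * Y) :=
          mul_le_mul_of_nonneg_left (hnum.trans hqτ) (by positivity)
  -- sum over `S`
  calc logHeight₁ (∏ q ∈ S, (q : ℚ) ^ expDiff c b q)
      ≤ ∑ q ∈ S, logHeight₁ ((q : ℚ) ^ expDiff c b q) := logHeight₁_prod_le _ _
    _ = ∑ q ∈ S, ((expDiff c b q).natAbs : ℝ) * Real.log q := by
        refine Finset.sum_congr rfl fun q hqS => ?_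
        have hqp : q.Prime := Nat.prime_of_mem_primeFactors (hS hqS)
        haveI : NeZero q := ⟨hqp.ne_zero⟩
        rw [logHeight₁_zpow, Rat.logHeight₁_natCast]
    _ ≤ ∑ q ∈ S, (theta K a b 0 + theta K a c 0) * (3 * τ * Y) := Finset.sum_le_sum hq
    _ = S.card * ((theta K a b 0 + theta K a c 0) * (3 * τ * Y)) := by
        rw [Finset.sum_const, nsmul_eq_mul]

/-- **All primes of `c` small.** If every prime of `c` is `≤ τ`, then
`log c ≤ ω(c) · Θ_{ab} · 3τY` (`ab > 1`). [cite: StewartYu2001, Theorem 1 (proof), as reconstructed] -/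
theorem log_le_of_primes_le_placeBounds (hK : 1 ≤ K)
    (hpadc : ∀ {a b c : ℕ}, IsABCTriple a b c → 1 < a * b → ∀ {p : ℕ}, p.Prime → p ∣ c →
      (c.factorization p : ℝ) * Real.log p < theta K a b 0 *
        ((p / Real.log p) * (Real.log p + Real.log (max (Real.exp 1) (2 * Real.log c)))))
    (h : IsABCTriple a b c) (h1 : 1 < a * b) {τ : ℝ} (hτ : ∀ q ∈ c.primeFactors, (q : ℝ) ≤ τ) :
    Real.log c ≤ c.primeFactors.card *
      (theta K a b 0 * (3 * τ * Real.log (max (Real.exp 1) (2 * Real.log c)))) := by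
  obtain ⟨ha, hb, habc, hcop⟩ := id h
  have hc : c ≠ 0 := by omega
  set Y := Real.log (max (Real.exp 1) (2 * Real.log c)) with hYdef
  have hY1 : 1 ≤ Y := one_le_log_max_exp _
  have hΘab : 0 ≤ theta K a b 0 := theta_nonneg (zero_le_one.trans hK) a b 0
  rw [log_eq_sum_factorization_mul_log hc]
  calc ∑ q ∈ c.primeFactors, (c.factorization q : ℝ) * Real.log q
      ≤ ∑ q ∈ c.primeFactors, theta K a b 0 * (3 * τ * Y) := by
        refine Finset.sum_le_sum fun q hqc => ?_
        have hqp := Nat.prime_of_mem_primeFactors hqc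
        have hq2 : (2 : ℝ) ≤ q := by exact_mod_cast hqp.two_le
        have hb1 := hpadc h h1 hqp (Nat.dvd_of_mem_primeFactors hqc)
        have hnum : (q : ℝ) / Real.log q * (Real.log q + Y) ≤ 3 * q * Y :=
          div_log_mul_add_le hq2 hY1
        have hqτ : 3 * (q : ℝ) * Y ≤ 3 * τ * Y := by
          have := hτ q hqc; nlinarith
        exact hb1.le.trans (mul_le_mul_of_nonneg_left (hnum.trans hqτ) hΘab)
    _ = c.primeFactors.card * (theta K a b 0 * (3 * τ * Y)) := by
        rw [Finset.sum_const, nsmul_eq_mul]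

end PlaceBoundsRoutes

end Literature.Barriers.ABC

end
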